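import Literature.Barriers.ValiantsHypothesis.BDGIL24HighestWeightProjectionProofs
import HarnessLib

/-!
# Isotypic components of a rational `GL_k`-representation are independent —
# "the `λ`-isotypic component" of [BDGIL24, Thm. 1.1 (2)] is well defined

Theorem-only companion of the BDGIL24 cluster (val-lit row vdBDGIL24-A). The typed statement
`BergEtAl2024.thm_1_1_isotypic` (file `BDGIL24IsotypicNaturalProofs.lean`) renders "the projection
of `Δ` onto the `λ`-isotypic component" by the characterisation `Δ' ∈ hwSubrep χ` and
`Δ − Δ' ∈ ⨆_{χ' ≠ χ} hwSubrep χ'`, where `hwSubrep ρ χ` is the span of the `GL`-translates of the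
highest-weight vectors of weight `χ` ([BDGIL24, §1 p.4–5 and §2.5]; Goodman–Wallach §4.1.6). That
characterisation pins `Δ'` down exactly when the subspaces `hwSubrep ρ χ` are INDEPENDENT. This
file proves the independence for every finite-dimensional rational representation of `GL σ k`
over a field of characteristic `0`:

* `exists_eq_add_lowWeight_of_mem_iSup_lowerSpan` — a nonzero WEIGHT vector of weight `ψ` in
  `⨆_i span (U⁻ · v_i)` (`v_i` highest-weight vectors of weights `χ_i`) has `ψ = χ_i + lowWeight n`
  for some `i` (induction on the generators: split off `span (U⁻ · v₀)` by an invariant complement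
  — complete reducibility, `isSemisimpleRepresentation_of_isRationalRep_holds` — and project);
* `weight_eq_of_mem_hwSubrep` — **a nonzero highest-weight vector lying in `hwSubrep ρ χ` has
  weight `χ`** (the isotypic component of type `χ` has no other highest weights);
* `hwSubrep_finset_independent` / `iSupIndep_hwSubrep` — **the isotypic components are
  independent** (`⨆` is a direct sum): in a dependency, the lexicographically largest weight
  `χ₀` with a nonzero term gives a nonzero stable intersection, which carries a highest-weight
  vector — of weight `χ₀` by the previous item, yet of weight `< χ₀` by the first;
* `isotypicProjection_unique` — for a finite-dimensional rational representation the element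
  `x'` with `x' ∈ hwSubrep χ`, `x − x' ∈ ⨆_{χ' ≠ χ} hwSubrep χ'` is unique (the shape of
  `thm_1_1_isotypic`, there for the locally finite representation `coordRep` on metapolynomials;
  the transfer to `coordRep` is by restriction to a finite-dimensional stable subspace:);
* `iSupIndep_hwSubrep_of_locallyFinite` — the same for a LOCALLY FINITE rational representation
  (every vector in a finite-dimensional subrepresentation): a dependency involves finitely many
  highest-weight vectors, which lie in a common finite-dimensional subrepresentation `U`, and
  `(hwSubrep U χ).map U.subtype` is spanned by the translates of those in `U`
  (`map_subtype_hwSubrep_toRepresentation`);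
* `iSupIndep_hwSubrep_coordRep`, **`isotypicComponent_unique`** — `coordRep (Fin k) ℂ d` is locally
  finite (`exists_subrepresentation_coordRep_mem`, from `exists_finset_forall_coordRep_mem_span`),
  so the `Δ'` of `thm_1_1_isotypic`'s characterisation is UNIQUE: "the projection onto the
  `λ`-isotypic component" of [BDGIL24, Thm. 1.1 (2)] is well defined in the tree's rendering;
* `iSupIndep_weightSpace` — the WEIGHT SPACES of any representation of `GL σ k` (`k` infinite) are
  independent (distinct weights are distinct torus characters, `eq_of_forall_weightChar_eq`);
  `weightComponent_unique` for `coordRep`;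
* `thm_1_1_weight_forall`, `thm_1_1_isotypic_forall` — [BDGIL24, Thm. 1.1 (1), (2)] for THE
  projection: the tree's `thm_1_1_weight_holds` / `thm_1_1_isotypic_holds` bound `cc` of SOME `Δ'`
  with the characterising property, and by uniqueness the bound holds for EVERY such `Δ'`;
* `disjoint_highestWeightSpace_sup_of_locallyFinite`, `hwvComponent_unique`,
  `thm_1_1_hwv_forall` — the same for [BDGIL24, Thm. 1.1 (3)]: the highest-weight space of
  weight `χ` meets `(⨆_{χ' ≠ χ} hwSubrep χ') + (⨆_{χ' ≠ χ} V_{χ'})` trivially (weight components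
  of a vector of a subrepresentation stay in it, `exists_sum_weightVectors_of_mem`; then weight-
  and isotypic independence), so `thm_1_1_hwv`'s `Δ'` is unique and its `cc` bound holds for it;
* `isInternal_hwSubrep_coordRep`, `isInternal_weightSpace_coordRep` — the space of
  format-`(*, d, k)` metapolynomials is the DIRECT SUM of its isotypic components, and of its
  weight spaces (exhaustive by `le_span_translates_highestWeight` / `exists_weightProj` on a
  finite-dimensional subrepresentation containing a given vector).
Sources: Goodman–Wallach GTM 255, §3.2.1 (highest-weight vectors), Cor. 3.2.3 and Thm. 3.3.11
(weights of cyclic modules, complete reducibility), §4.1.6 (isotypic decomposition);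
Fulton–Harris §15.3. Tools: the tree's `GLHighestWeight*` files (`lowerSpan`,
`exists_eq_add_lowWeight_of_mem_lowerSpan`, `toLex_add_lowWeight_lt`, `exists_isCompl` for
`Subrepresentation` under complete reducibility). No definitions, no named facts. Honest framing:
representation-theoretic bookkeeping; nothing here bears on `VP ≠ VNP`.
-/

noncomputable section

open Literature.NumberTheory.DiophantineGeometry

namespace Literature.Barriers.ValiantsHypothesis

namespace BergEtAl2024

section General

variable {σ k V : Type*} [Fintype σ] [LinearOrder σ] [Field k] [AddCommGroup V] [Module k V]

/-! ### Equivariant endomorphisms and projections -/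

/-- An endomorphism commuting with the group preserves weight spaces.
[cite: GoodmanWallachGTM255, §3.2.1] -/
theorem apply_mem_weightSpace_of_comm {ρ : Representation k (GL σ k) V} {P : V →ₗ[k] V}
    (hP : ∀ (g : GL σ k) (v : V), P (ρ g v) = ρ g (P v)) {χ : Weight σ} {v : V}
    (hv : v ∈ weightSpace ρ χ) : P v ∈ weightSpace ρ χ := by
  intro t ht
  rw [← hP, hv t ht, map_smul]

/-- An endomorphism commuting with the group preserves highest-weight vectors.
[cite: GoodmanWallachGTM255, §3.2.1] -/
theorem apply_mem_highestWeightSpace_of_comm {ρ : Representation k (GL σ k) V} {P : V →ₗ[k] V}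
    (hP : ∀ (g : GL σ k) (v : V), P (ρ g v) = ρ g (P v)) {χ : Weight σ} {v : V}
    (hv : v ∈ highestWeightSpace ρ χ) : P v ∈ highestWeightSpace ρ χ := by
  intro g hg
  rw [← hP, hv g hg, map_smul]

/-- `IsCompl` of subrepresentations is `IsCompl` of the underlying submodules.
[cite: GoodmanWallachGTM255, Thm. 3.3.11] -/
theorem isCompl_toSubmodule {ρ : Representation k (GL σ k) V} {A B : Subrepresentation ρ}
    (h : IsCompl A B) : IsCompl A.toSubmodule B.toSubmodule := by
  refine ⟨disjoint_iff.2 ?_, codisjoint_iff.2 ?_⟩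
  · rw [← Subrepresentation.toSubmodule_inf, h.inf_eq_bot]
    rfl
  · rw [← Subrepresentation.toSubmodule_sup, h.sup_eq_top]
    rfl

/-- **The projection onto a subrepresentation along an invariant complement commutes with the
group.** [cite: GoodmanWallachGTM255, Thm. 3.3.11] -/
theorem projection_comm {ρ : Representation k (GL σ k) V} (A B : Subrepresentation ρ)
    (h : IsCompl A.toSubmodule B.toSubmodule) (g : GL σ k) (v : V) :
    A.toSubmodule.projection B.toSubmodule h (ρ g v) =
      ρ g (A.toSubmodule.projection B.toSubmodule h v) := by
  set a := A.toSubmodule.projection B.toSubmodule h v with ha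
  have hb : v - a ∈ B.toSubmodule := Submodule.sub_projection_mem h v
  have haA : a ∈ A.toSubmodule := Submodule.projection_apply_mem h v
  have hsplit : ρ g v = ρ g a + ρ g (v - a) := by rw [← map_add, add_sub_cancel]
  rw [hsplit, map_add, (Submodule.projection_eq_self_iff h _).2 (A.apply_mem_toSubmodule g haA),
    (Submodule.projection_apply_eq_zero_iff h).2 (B.apply_mem_toSubmodule g hb), add_zero]

/-! ### The cyclic modules `span (U⁻ · v)` -/

/-- `span (U⁻ · v)` is `GL`-stable for a highest-weight vector `v` (it is the span of the orbit).
[cite: GoodmanWallachGTM255, Cor. 3.2.3] -/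
theorem apply_mem_lowerSpan_of_mem [Infinite k] {ρ : Representation k (GL σ k) V}
    (hρ : IsRationalRep ρ) {χ : Weight σ} {v : V} (hv : v ∈ highestWeightSpace ρ χ) (g : GL σ k)
    {x : V} (hx : x ∈ lowerSpan ρ v) : ρ g x ∈ lowerSpan ρ v := by
  rw [← span_orbit_eq_lowerSpan hρ hv] at hx ⊢
  refine Submodule.span_induction (fun y hy => ?_) (by rw [map_zero]; exact Submodule.zero_mem _)
    (fun y z _ _ hy hz => by rw [map_add]; exact Submodule.add_mem _ hy hz)
    (fun c y _ hy => by rw [map_smul]; exact Submodule.smul_mem _ c hy) hx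
  obtain ⟨g', rfl⟩ := hy
  refine Submodule.subset_span ⟨g * g', ?_⟩
  show ρ (g * g') v = ρ g (ρ g' v)
  rw [map_mul]
  rfl

/-- The image of `span (U⁻ · v)` under an endomorphism commuting with the group is
`span (U⁻ · P v)`. [cite: GoodmanWallachGTM255, Cor. 3.2.3] -/
theorem map_lowerSpan_of_comm {ρ : Representation k (GL σ k) V} {P : V →ₗ[k] V}
    (hP : ∀ (g : GL σ k) (v : V), P (ρ g v) = ρ g (P v)) (v : V) :
    (lowerSpan ρ v).map P = lowerSpan ρ (P v) := by
  unfold lowerSpan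
  have h : (⇑P ∘ fun a : LowIdx σ → k => ρ (lowerUnitri a) v) =
      fun a : LowIdx σ → k => ρ (lowerUnitri a) (P v) := funext fun a => hP _ _
  rw [Submodule.map_span, ← Set.range_comp, h]

/-- **Weights of a sum of cyclic modules.** If `v_i` (`i ∈ s`) are highest-weight vectors of
weights `χ_i` and `u ≠ 0` is a weight vector of weight `ψ` in `⨆_{i ∈ s} span (U⁻ · v_i)`, then
`ψ = χ_i + lowWeight n` for some `i ∈ s` and `n` (so `ψ ≤ χ_i` lexicographically). Induction on `s`:
split off `span (U⁻ · v₀)` with an invariant complement and project.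
[cite: GoodmanWallachGTM255, Cor. 3.2.3 with Thm. 3.3.11] -/
theorem exists_eq_add_lowWeight_of_mem_iSup_lowerSpan [CharZero k] [FiniteDimensional k V]
    {ρ : Representation k (GL σ k) V} (hρ : IsRationalRep ρ) {ι : Type*} (s : Finset ι)
    (χ : ι → Weight σ) :
    ∀ (v : ι → V), (∀ i ∈ s, v i ∈ highestWeightSpace ρ (χ i)) →
      ∀ {u : V} {ψ : Weight σ}, u ∈ (⨆ i ∈ s, lowerSpan ρ (v i)) → u ∈ weightSpace ρ ψ → u ≠ 0 →
        ∃ i ∈ s, ∃ n : LowIdx σ →₀ ℕ, ψ = χ i + lowWeight n := by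
  classical
  haveI : Infinite k := Infinite.of_injective (Nat.cast : ℕ → k) Nat.cast_injective
  haveI : ρ.IsSemisimpleRepresentation :=
    isSemisimpleRepresentation_of_isRationalRep_holds (σ := σ) (k := k) (V := V) hρ
  induction s using Finset.induction_on with
  | empty =>
    intro v _ u ψ hu _ hu0
    simp only [Finset.notMem_empty, not_false_eq_true, iSup_neg, iSup_bot, Submodule.mem_bot]
      at hu
    exact absurd hu hu0
  | insert i₀ s hi₀ ih =>
    intro v hv u ψ hu huψ hu0
    have hv₀ : v i₀ ∈ highestWeightSpace ρ (χ i₀) := hv i₀ (Finset.mem_insert_self _ _)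
    -- `L = span (U⁻ · v i₀)` as a subrepresentation, with an invariant complement `C`
    let L : Subrepresentation ρ :=
      ⟨lowerSpan ρ (v i₀), fun g x hx => apply_mem_lowerSpan_of_mem hρ hv₀ g hx⟩
    obtain ⟨C, hLC⟩ := exists_isCompl L
    have hc : IsCompl L.toSubmodule C.toSubmodule := isCompl_toSubmodule hLC
    set Q := L.toSubmodule.projection C.toSubmodule hc with hQ
    set P := C.toSubmodule.projection L.toSubmodule hc.symm with hP
    have hQcomm : ∀ (g : GL σ k) (x : V), Q (ρ g x) = ρ g (Q x) := projection_comm L C hc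
    have hPcomm : ∀ (g : GL σ k) (x : V), P (ρ g x) = ρ g (P x) := projection_comm C L hc.symm
    by_cases hQu : Q u = 0
    · -- `u = P u` lies in `⨆_{i ∈ s} span (U⁻ · P (v i))`: induction hypothesis
      have huP : P u = u := by
        have := Submodule.projection_add_projection_eq_self hc u
        rw [hQu, zero_add] at this
        exact this
      rw [Finset.iSup_insert, Submodule.mem_sup] at hu
      obtain ⟨l, hl, w, hw, rfl⟩ := hu
      have hPl : P l = 0 := (Submodule.projection_apply_eq_zero_iff hc.symm).2 hl
      have hPw : P w ∈ ⨆ i ∈ s, lowerSpan ρ (P (v i)) := by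
        have h1 : P w ∈ (⨆ i ∈ s, lowerSpan ρ (v i)).map P := Submodule.mem_map_of_mem hw
        simp only [Submodule.map_iSup, map_lowerSpan_of_comm hPcomm] at h1
        exact h1
      have hu' : l + w ∈ ⨆ i ∈ s, lowerSpan ρ (P (v i)) := by
        rw [← huP, map_add, hPl, zero_add]
        exact hPw
      obtain ⟨i, hi, n, hn⟩ := ih (fun i => P (v i))
        (fun i hi => apply_mem_highestWeightSpace_of_comm hPcomm (hv i (Finset.mem_insert_of_mem hi)))
        hu' huψ hu0
      exact ⟨i, Finset.mem_insert_of_mem hi, n, hn⟩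
    · -- `Q u ≠ 0` is a weight vector of weight `ψ` in `span (U⁻ · v i₀)`
      have hQuL : Q u ∈ lowerSpan ρ (v i₀) := Submodule.projection_apply_mem hc u
      obtain ⟨n, hn⟩ := exists_eq_add_lowWeight_of_mem_lowerSpan hρ
        (highestWeightSpace_le_weightSpace _ _ hv₀) hQuL (apply_mem_weightSpace_of_comm hQcomm huψ) hQu
      exact ⟨i₀, Finset.mem_insert_self _ _, n, hn⟩

/-! ### Highest-weight vectors inside an isotypic component -/

/-- **Weights of a finite sum of isotypic components**: a nonzero weight vector of weight `ψ` in
`⨆_{χ ∈ W} hwSubrep ρ χ` has `ψ = χ + lowWeight n` for some `χ ∈ W` (so `ψ ≤ χ` lexicographically).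
[cite: GoodmanWallachGTM255, Cor. 3.2.3 with §4.1.6] -/
theorem exists_eq_add_lowWeight_of_mem_iSup_hwSubrep [CharZero k] [FiniteDimensional k V]
    {ρ : Representation k (GL σ k) V} (hρ : IsRationalRep ρ) (W : Finset (Weight σ)) {u : V}
    {ψ : Weight σ} (hu : u ∈ ⨆ χ ∈ W, hwSubrep ρ χ) (huψ : u ∈ weightSpace ρ ψ) (hu0 : u ≠ 0) :
    ∃ χ ∈ W, ∃ n : LowIdx σ →₀ ℕ, ψ = χ + lowWeight n := by
  classical
  haveI : Infinite k := Infinite.of_injective (Nat.cast : ℕ → k) Nat.cast_injective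
  -- the generators: translates of highest-weight vectors of the weights in `W`
  set S : Set V := ⋃ χ ∈ W, {w | ∃ g : GL σ k, ∃ v ∈ highestWeightSpace ρ χ, w = ρ g v} with hS
  have hle : (⨆ χ ∈ W, hwSubrep ρ χ) ≤ Submodule.span k S := by
    refine iSup₂_le fun χ hχ => ?_
    exact Submodule.span_mono (Set.subset_biUnion_of_mem (u := fun χ =>
      {w | ∃ g : GL σ k, ∃ v ∈ highestWeightSpace ρ χ, w = ρ g v}) hχ)
  obtain ⟨T, hTS, huT⟩ := Submodule.mem_span_finite_of_mem_span (hle hu)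
  have hgen : ∀ t ∈ T, ∃ χ ∈ W, ∃ g : GL σ k, ∃ v ∈ highestWeightSpace ρ χ, t = ρ g v := by
    intro t ht
    have htS : t ∈ S := hTS ht
    simp only [hS, Set.mem_iUnion, Set.mem_setOf_eq] at htS
    obtain ⟨χ, hχ, g, v, hv, htv⟩ := htS
    exact ⟨χ, hχ, g, v, hv, htv⟩
  choose! wt hwt g v hv htv using hgen
  have hle' : Submodule.span k (T : Set V) ≤ ⨆ t ∈ T, lowerSpan ρ (v t) := by
    refine Submodule.span_le.2 fun t ht => ?_
    have h1 : t ∈ lowerSpan ρ (v t) := by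
      have h2 := apply_mem_lowerSpan hρ (hv t ht) (g t)
      rwa [← htv t ht] at h2
    exact Submodule.mem_iSup_of_mem t (Submodule.mem_iSup_of_mem ht h1)
  obtain ⟨t, ht, n, hn⟩ := exists_eq_add_lowWeight_of_mem_iSup_lowerSpan hρ T wt v
    (fun t ht => hv t ht) (hle' huT) huψ hu0
  exact ⟨wt t, hwt t ht, n, hn⟩

/-- **A nonzero highest-weight vector lying in the isotypic component `hwSubrep ρ χ` has weight
`χ`** (finite-dimensional rational representation, characteristic `0`): the component of type `χ`
carries no other highest weight. (`ψ ≤ χ` by the weights of the cyclic modules generating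
`hwSubrep ρ χ`; `χ ≤ ψ` by projecting the generators onto `span (U⁻ · u)` along an invariant
complement.) [cite: GoodmanWallachGTM255, §4.1.6 with Cor. 3.2.3] -/
theorem weight_eq_of_mem_hwSubrep [CharZero k] [FiniteDimensional k V]
    {ρ : Representation k (GL σ k) V} (hρ : IsRationalRep ρ) {χ ψ : Weight σ} {u : V}
    (hu : u ∈ hwSubrep ρ χ) (huψ : u ∈ highestWeightSpace ρ ψ) (hu0 : u ≠ 0) : ψ = χ := by
  classical
  haveI : Infinite k := Infinite.of_injective (Nat.cast : ℕ → k) Nat.cast_injective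
  haveI : ρ.IsSemisimpleRepresentation :=
    isSemisimpleRepresentation_of_isRationalRep_holds (σ := σ) (k := k) (V := V) hρ
  -- (ii) `ψ = χ + lowWeight m`
  have hu' : u ∈ ⨆ χ' ∈ ({χ} : Finset (Weight σ)), hwSubrep ρ χ' := by
    rw [Finset.iSup_singleton]
    exact hu
  obtain ⟨χ', hχ', m, hm⟩ := exists_eq_add_lowWeight_of_mem_iSup_hwSubrep hρ {χ} hu'
    (highestWeightSpace_le_weightSpace _ _ huψ) hu0
  rw [Finset.mem_singleton] at hχ'
  rw [hχ'] at hm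
  -- (i) `χ = ψ + lowWeight n`: project onto `span (U⁻ · u)` along an invariant complement
  let L : Subrepresentation ρ :=
    ⟨lowerSpan ρ u, fun g x hx => apply_mem_lowerSpan_of_mem hρ huψ g hx⟩
  obtain ⟨C, hLC⟩ := exists_isCompl L
  have hc : IsCompl L.toSubmodule C.toSubmodule := isCompl_toSubmodule hLC
  set Q := L.toSubmodule.projection C.toSubmodule hc with hQ
  have hQcomm : ∀ (g : GL σ k) (x : V), Q (ρ g x) = ρ g (Q x) := projection_comm L C hc
  have hQu : Q u = u := (Submodule.projection_eq_self_iff hc u).2 (self_mem_lowerSpan ρ u)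
  have hex : ∃ v ∈ highestWeightSpace ρ χ, Q v ≠ 0 := by
    by_contra hnot
    push Not at hnot
    have hker : hwSubrep ρ χ ≤ LinearMap.ker Q := by
      refine Submodule.span_le.2 ?_
      rintro _ ⟨g, v, hv, rfl⟩
      rw [SetLike.mem_coe, LinearMap.mem_ker, hQcomm, hnot v hv, map_zero]
    have h0 : Q u = 0 := LinearMap.mem_ker.1 (hker hu)
    rw [hQu] at h0
    exact hu0 h0
  obtain ⟨v, hv, hQv⟩ := hex
  obtain ⟨n, hn⟩ := exists_eq_add_lowWeight_of_mem_lowerSpan hρ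
    (highestWeightSpace_le_weightSpace _ _ huψ) (Submodule.projection_apply_mem hc v)
    (apply_mem_weightSpace_of_comm hQcomm (highestWeightSpace_le_weightSpace _ _ hv)) hQv
  -- combine: `χ = ψ + lowWeight n`, `ψ = χ + lowWeight m` ⇒ `m = n = 0`
  have hsum : lowWeight (m + n) = 0 := by
    rw [lowWeight_add]
    have e : χ = χ + (lowWeight m + lowWeight n) := by
      conv_lhs => rw [hn, hm]
      rw [add_assoc]
    exact left_eq_add.mp e
  have hmn : m + n = 0 := eq_zero_of_lowWeight_eq_zero hsum
  have hm0 : m = 0 := by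
    ext q
    have := DFunLike.congr_fun hmn q
    rw [Finsupp.add_apply, Finsupp.zero_apply] at this
    rw [Finsupp.zero_apply]
    omega
  rw [hm, hm0, lowWeight_zero, add_zero]

/-! ### Independence of the isotypic components -/

/-- `⨆_{χ ∈ W} hwSubrep ρ χ` is `GL`-stable. [cite: GoodmanWallachGTM255, §4.1.6] -/
theorem map_iSup_hwSubrep_le {ρ : Representation k (GL σ k) V} (W : Finset (Weight σ))
    (g : GL σ k) : (⨆ χ ∈ W, hwSubrep ρ χ).map (ρ g) ≤ ⨆ χ ∈ W, hwSubrep ρ χ := by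
  simp only [Submodule.map_iSup]
  exact iSup₂_mono fun χ _ => map_hwSubrep_le ρ χ g

/-- **Independence, finite form**: if `y_χ ∈ hwSubrep ρ χ` for `χ ∈ T` and `Σ_{χ ∈ T} y_χ = 0`, then
every `y_χ = 0` (finite-dimensional rational representation, characteristic `0`). At the
lexicographically largest weight `χ₀` with `y_{χ₀} ≠ 0` the stable subspace
`hwSubrep χ₀ ⊓ ⨆_{χ ≠ χ₀} hwSubrep χ` is nonzero, hence has a highest-weight vector — of weight `χ₀`
(`weight_eq_of_mem_hwSubrep`) and of weight `< χ₀` (`exists_eq_add_lowWeight_of_mem_iSup_hwSubrep`).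
[cite: GoodmanWallachGTM255, §4.1.6 (isotypic decomposition)] -/
theorem hwSubrep_finset_independent [CharZero k] [FiniteDimensional k V]
    {ρ : Representation k (GL σ k) V} (hρ : IsRationalRep ρ) (T : Finset (Weight σ))
    (y : Weight σ → V) (hy : ∀ χ ∈ T, y χ ∈ hwSubrep ρ χ) (hsum : ∑ χ ∈ T, y χ = 0) :
    ∀ χ ∈ T, y χ = 0 := by
  classical
  haveI : Infinite k := Infinite.of_injective (Nat.cast : ℕ → k) Nat.cast_injective
  by_contra hne
  push Not at hne
  obtain ⟨χ₁, hχ₁T, hχ₁⟩ := hne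
  set T' := T.filter fun χ => y χ ≠ 0 with hT'
  have hT'ne : T'.Nonempty := ⟨χ₁, Finset.mem_filter.2 ⟨hχ₁T, hχ₁⟩⟩
  obtain ⟨χ₀, hχ₀T', hmax⟩ := Finset.exists_max_image T' (fun χ => toLex χ) hT'ne
  have hχ₀T : χ₀ ∈ T := (Finset.mem_filter.1 hχ₀T').1
  have hy₀ : y χ₀ ≠ 0 := (Finset.mem_filter.1 hχ₀T').2
  have hsumT' : ∑ χ ∈ T', y χ = 0 := by
    rw [hT', Finset.sum_filter_ne_zero]
    exact hsum
  have hy₀eq : y χ₀ = -∑ χ ∈ T'.erase χ₀, y χ := by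
    rw [← Finset.add_sum_erase T' y hχ₀T'] at hsumT'
    exact eq_neg_of_add_eq_zero_left hsumT'
  have hmem : y χ₀ ∈ ⨆ χ ∈ T'.erase χ₀, hwSubrep ρ χ := by
    rw [hy₀eq]
    refine Submodule.neg_mem _ (Submodule.sum_mem _ fun χ hχ => ?_)
    have hχT : χ ∈ T := (Finset.mem_filter.1 (Finset.mem_of_mem_erase hχ)).1
    exact Submodule.mem_iSup_of_mem χ (Submodule.mem_iSup_of_mem hχ (hy χ hχT))
  -- the stable intersection
  set M : Submodule k V := hwSubrep ρ χ₀ ⊓ ⨆ χ ∈ T'.erase χ₀, hwSubrep ρ χ with hM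
  have hMstab : ∀ g, M ≤ M.comap (ρ g) := by
    intro g
    rw [← Submodule.map_le_iff_le_comap]
    refine (Submodule.map_inf_le _).trans ?_
    exact inf_le_inf (map_hwSubrep_le ρ χ₀ g) (map_iSup_hwSubrep_le _ g)
  have hM0 : M ≠ ⊥ := by
    intro h
    have hyM : y χ₀ ∈ M := Submodule.mem_inf.2 ⟨hy χ₀ hχ₀T, hmem⟩
    rw [h, Submodule.mem_bot] at hyM
    exact hy₀ hyM
  obtain ⟨ψ, u, huM, hu0, huψ⟩ := exists_mem_highestWeightSpace_of_stable hρ M hMstab hM0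
  obtain ⟨hu₁, hu₂⟩ := Submodule.mem_inf.1 huM
  have hψ : ψ = χ₀ := weight_eq_of_mem_hwSubrep hρ hu₁ huψ hu0
  obtain ⟨χ, hχ, m, hm⟩ := exists_eq_add_lowWeight_of_mem_iSup_hwSubrep hρ (T'.erase χ₀) hu₂
    (highestWeightSpace_le_weightSpace _ _ huψ) hu0
  obtain ⟨hχne, hχT'⟩ := Finset.mem_erase.1 hχ
  have hm0 : m ≠ 0 := by
    rintro rfl
    rw [lowWeight_zero, add_zero] at hm
    exact hχne (hm.symm.trans hψ)
  have hlt : toLex ψ < toLex χ := by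
    rw [hm]
    exact toLex_add_lowWeight_lt χ hm0
  rw [hψ] at hlt
  exact absurd (hmax χ hχT') (not_le.2 hlt)

/-- **The isotypic components `hwSubrep ρ χ` of a finite-dimensional rational `GL`-representation
(characteristic `0`) are independent**: `⨆_χ hwSubrep ρ χ` is a direct sum.
[cite: GoodmanWallachGTM255, §4.1.6 (isotypic decomposition)] -/
theorem iSupIndep_hwSubrep [CharZero k] [FiniteDimensional k V]
    {ρ : Representation k (GL σ k) V} (hρ : IsRationalRep ρ) :
    iSupIndep fun χ => hwSubrep ρ χ := by
  classical
  intro χ₀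
  rw [Submodule.disjoint_def]
  intro x hx hx'
  obtain ⟨f, hf, hfx⟩ := (Submodule.mem_iSup_iff_exists_finsupp _ x).1 hx'
  have hf₀ : f χ₀ = 0 := by
    have h := hf χ₀
    simp only [ne_eq, not_true_eq_false, iSup_false, Submodule.mem_bot] at h
    exact h
  have hfχ : ∀ χ, χ ≠ χ₀ → f χ ∈ hwSubrep ρ χ := by
    intro χ hχ
    have h := hf χ
    simp only [ne_eq, hχ, not_false_eq_true, iSup_pos] at h
    exact h
  have hχ₀supp : χ₀ ∉ f.support := by
    rw [Finsupp.mem_support_iff, not_not]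
    exact hf₀
  -- the family `y`: `-x` at `χ₀`, `f χ` elsewhere
  set y : Weight σ → V := fun χ => if χ = χ₀ then -x else f χ with hy
  have hyT : ∀ χ ∈ insert χ₀ f.support, y χ ∈ hwSubrep ρ χ := by
    intro χ _
    by_cases h : χ = χ₀
    · subst h
      simp only [hy, if_true]
      exact Submodule.neg_mem _ hx
    · simp only [hy, h, if_false]
      exact hfχ χ h
  have hsum : ∑ χ ∈ insert χ₀ f.support, y χ = 0 := by
    rw [Finset.sum_insert hχ₀supp]
    have h1 : ∑ χ ∈ f.support, y χ = ∑ χ ∈ f.support, f χ :=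
      Finset.sum_congr rfl fun χ hχ => by
        have hne : χ ≠ χ₀ := fun h => hχ₀supp (h ▸ hχ)
        simp only [hy, hne, if_false]
    rw [h1]
    have h2 : ∑ χ ∈ f.support, f χ = x := hfx
    rw [h2]
    simp only [hy, if_true, neg_add_cancel]
  have h := hwSubrep_finset_independent hρ (insert χ₀ f.support) y hyT hsum χ₀
    (Finset.mem_insert_self _ _)
  simp only [hy, if_true, neg_eq_zero] at h
  exact h

/-- **"The" projection onto the `χ`-isotypic component is well defined**: for a
finite-dimensional rational representation (characteristic `0`) there is at most one `x'` with
`x' ∈ hwSubrep ρ χ` and `x − x' ∈ ⨆_{χ' ≠ χ} hwSubrep ρ χ'` — the characterisation of the isotypic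
projection used in the typed [BDGIL24, Thm. 1.1 (2)] (`thm_1_1_isotypic`).
[cite: BergEtAl2024, Thm. 1.1 (2), p.4 (PDF p.5)] -/
theorem isotypicProjection_unique [CharZero k] [FiniteDimensional k V]
    {ρ : Representation k (GL σ k) V} (hρ : IsRationalRep ρ) {χ : Weight σ} {x x₁ x₂ : V}
    (h₁ : x₁ ∈ hwSubrep ρ χ) (h₁' : x - x₁ ∈ ⨆ χ' ∈ {χ' : Weight σ | χ' ≠ χ}, hwSubrep ρ χ')
    (h₂ : x₂ ∈ hwSubrep ρ χ) (h₂' : x - x₂ ∈ ⨆ χ' ∈ {χ' : Weight σ | χ' ≠ χ}, hwSubrep ρ χ') :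
    x₁ = x₂ := by
  have hd := iSupIndep_hwSubrep hρ χ
  rw [Submodule.disjoint_def] at hd
  have hmem : x₁ - x₂ ∈ ⨆ χ' ∈ {χ' : Weight σ | χ' ≠ χ}, hwSubrep ρ χ' := by
    have : x₁ - x₂ = (x - x₂) - (x - x₁) := by abel
    rw [this]
    exact Submodule.sub_mem _ h₂' h₁'
  have hmem' : x₁ - x₂ ∈ ⨆ (χ') (_ : χ' ≠ χ), hwSubrep ρ χ' := by
    simpa only [Set.mem_setOf_eq] using hmem
  exact sub_eq_zero.1 (hd _ (Submodule.sub_mem _ h₁ h₂) hmem')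

/-! ### Independence of the weight spaces -/

/-- From finite independence to `iSupIndep` (direct sums, finite test).
[cite: GoodmanWallachGTM255, Thm. 3.1.16] -/
theorem iSupIndep_of_finset_sum_eq_zero {ι : Type*} (p : ι → Submodule k V)
    (h : ∀ (T : Finset ι) (y : ι → V), (∀ i ∈ T, y i ∈ p i) → ∑ i ∈ T, y i = 0 →
      ∀ i ∈ T, y i = 0) : iSupIndep p := by
  classical
  intro i₀
  rw [Submodule.disjoint_def]
  intro x hx hx'
  obtain ⟨f, hf, hfx⟩ := (Submodule.mem_iSup_iff_exists_finsupp _ x).1 hx'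
  have hf₀ : f i₀ = 0 := by
    have h := hf i₀
    simp only [ne_eq, not_true_eq_false, iSup_false, Submodule.mem_bot] at h
    exact h
  have hfi : ∀ i, i ≠ i₀ → f i ∈ p i := by
    intro i hi
    have h := hf i
    simp only [ne_eq, hi, not_false_eq_true, iSup_pos] at h
    exact h
  have hi₀supp : i₀ ∉ f.support := by
    rw [Finsupp.mem_support_iff, not_not]
    exact hf₀
  set y : ι → V := fun i => if i = i₀ then -x else f i with hy
  have hyT : ∀ i ∈ insert i₀ f.support, y i ∈ p i := by
    intro i _
    by_cases h : i = i₀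
    · subst h
      simp only [hy, if_true]
      exact Submodule.neg_mem _ hx
    · simp only [hy, h, if_false]
      exact hfi i h
  have hsum : ∑ i ∈ insert i₀ f.support, y i = 0 := by
    rw [Finset.sum_insert hi₀supp]
    have h1 : ∑ i ∈ f.support, y i = ∑ i ∈ f.support, f i :=
      Finset.sum_congr rfl fun i hi => by
        have hne : i ≠ i₀ := fun h => hi₀supp (h ▸ hi)
        simp only [hy, hne, if_false]
    rw [h1]
    have h2 : ∑ i ∈ f.support, f i = x := hfx
    rw [h2]
    simp only [hy, if_true, neg_add_cancel]
  have h' := h (insert i₀ f.support) y hyT hsum i₀ (Finset.mem_insert_self _ _)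
  simp only [hy, if_true, neg_eq_zero] at h'
  exact h'

/-- **The weight spaces of a representation of `GL σ k` (`k` infinite) are independent**, finite
form: distinct weights are distinct characters of the diagonal torus
(`eq_of_forall_weightChar_eq`); induction on the number of terms, applying `ρ(t) − t^{χ₀}`.
[cite: GoodmanWallachGTM255, Thm. 3.1.16] -/
theorem weightSpace_finset_independent [Infinite k] (ρ : Representation k (GL σ k) V)
    (T : Finset (Weight σ)) :
    ∀ (y : Weight σ → V), (∀ χ ∈ T, y χ ∈ weightSpace ρ χ) → ∑ χ ∈ T, y χ = 0 →
      ∀ χ ∈ T, y χ = 0 := by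
  classical
  induction T using Finset.induction_on with
  | empty => intro y _ _ χ hχ; exact absurd hχ (Finset.notMem_empty χ)
  | insert χ₀ T hχ₀ ih =>
    intro y hy hsum χ hχ
    have key : ∀ t : GL σ k, IsDiagonalGL t →
        ∀ χ ∈ T, (weightChar χ t - weightChar χ₀ t) • y χ = 0 := by
      intro t ht
      refine ih (fun χ => (weightChar χ t - weightChar χ₀ t) • y χ)
        (fun χ hχT => Submodule.smul_mem _ _ (hy χ (Finset.mem_insert_of_mem hχT))) ?_
      have h1 : ∑ χ ∈ insert χ₀ T, (weightChar χ t - weightChar χ₀ t) • y χ = 0 := by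
        have e : ∑ χ ∈ insert χ₀ T, (weightChar χ t - weightChar χ₀ t) • y χ =
            ρ t (∑ χ ∈ insert χ₀ T, y χ) - weightChar χ₀ t • ∑ χ ∈ insert χ₀ T, y χ := by
          rw [map_sum, Finset.smul_sum, ← Finset.sum_sub_distrib]
          refine Finset.sum_congr rfl fun χ hχ => ?_
          rw [sub_smul, hy χ hχ t ht]
        rw [e, hsum, map_zero, smul_zero, sub_zero]
      rwa [Finset.sum_insert hχ₀, sub_self, zero_smul, zero_add] at h1
    have hT : ∀ χ ∈ T, y χ = 0 := by
      intro χ hχT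
      have hne : χ ≠ χ₀ := fun h => hχ₀ (h ▸ hχT)
      obtain ⟨t, ht, hneq⟩ : ∃ t : GL σ k, IsDiagonalGL t ∧ weightChar χ t ≠ weightChar χ₀ t := by
        by_contra hall
        push Not at hall
        exact hne (eq_of_forall_weightChar_eq hall)
      exact (smul_eq_zero.mp (key t ht χ hχT)).resolve_left (sub_ne_zero.mpr hneq)
    rcases Finset.mem_insert.1 hχ with rfl | hχT
    · rw [Finset.sum_insert hχ₀, Finset.sum_eq_zero hT, add_zero] at hsum
      exact hsum
    · exact hT χ hχT

/-- **The weight spaces `V_χ` of a representation of `GL σ k` (`k` infinite) are independent**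
(no finiteness or rationality needed). [cite: GoodmanWallachGTM255, Thm. 3.1.16] -/
theorem iSupIndep_weightSpace [Infinite k] (ρ : Representation k (GL σ k) V) :
    iSupIndep fun χ => weightSpace ρ χ :=
  iSupIndep_of_finset_sum_eq_zero _ (weightSpace_finset_independent ρ)

omit [Fintype σ] [LinearOrder σ] in
/-- From independence of a family `p`: "`x' ∈ p χ` and `x − x' ∈ ⨆_{χ' ≠ χ} p χ'`" determines `x'`.
[cite: BergEtAl2024, Thm. 1.1, p.4 (PDF p.5)] -/
theorem eq_of_iSupIndep {ρχ : Weight σ → Submodule k V} (hind : iSupIndep ρχ) {χ : Weight σ}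
    {x x₁ x₂ : V} (h₁ : x₁ ∈ ρχ χ) (h₁' : x - x₁ ∈ ⨆ χ' ∈ {χ' : Weight σ | χ' ≠ χ}, ρχ χ')
    (h₂ : x₂ ∈ ρχ χ) (h₂' : x - x₂ ∈ ⨆ χ' ∈ {χ' : Weight σ | χ' ≠ χ}, ρχ χ') : x₁ = x₂ := by
  have hd := hind χ
  rw [Submodule.disjoint_def] at hd
  have hmem : x₁ - x₂ ∈ ⨆ χ' ∈ {χ' : Weight σ | χ' ≠ χ}, ρχ χ' := by
    have : x₁ - x₂ = (x - x₂) - (x - x₁) := by abel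
    rw [this]
    exact Submodule.sub_mem _ h₂' h₁'
  have hmem' : x₁ - x₂ ∈ ⨆ (χ') (_ : χ' ≠ χ), ρχ χ' := by
    simpa only [Set.mem_setOf_eq] using hmem
  exact sub_eq_zero.1 (hd _ (Submodule.sub_mem _ h₁ h₂) hmem')

/-! ### Locally finite representations -/

/-- The image in `V` of the `χ`-isotypic component of a subrepresentation `U` is the span of the
translates of the highest-weight vectors of weight `χ` of `V` lying in `U`.
[cite: GoodmanWallachGTM255, §4.1.6] -/
theorem map_subtype_hwSubrep_toRepresentation {ρ : Representation k (GL σ k) V}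
    (U : Subrepresentation ρ) (χ : Weight σ) :
    (hwSubrep U.toRepresentation χ).map U.toSubmodule.subtype =
      Submodule.span k {w | ∃ g : GL σ k, ∃ v ∈ highestWeightSpace ρ χ,
        v ∈ U.toSubmodule ∧ w = ρ g v} := by
  unfold hwSubrep
  rw [Submodule.map_span]
  congr 1
  ext w
  constructor
  · rintro ⟨y, ⟨g, v, hv, rfl⟩, rfl⟩
    exact ⟨g, (v : V), (mem_highestWeightSpace_toRepresentation_iff U χ v).1 hv, v.2, rfl⟩
  · rintro ⟨g, v, hv, hvU, rfl⟩
    exact ⟨U.toRepresentation g ⟨v, hvU⟩, ⟨g, ⟨v, hvU⟩,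
      (mem_highestWeightSpace_toRepresentation_iff U χ ⟨v, hvU⟩).2 hv, rfl⟩, rfl⟩

/-- Finitely many vectors of a locally finite representation lie in a common finite-dimensional
subrepresentation. [cite: GoodmanWallachGTM255, §4.1.6] -/
theorem exists_subrepresentation_finiteDimensional_forall_mem {ρ : Representation k (GL σ k) V}
    (hlf : ∀ v : V, ∃ U : Subrepresentation ρ, v ∈ U.toSubmodule ∧ FiniteDimensional k U.toSubmodule)
    (F : Finset V) :
    ∃ U : Subrepresentation ρ, FiniteDimensional k U.toSubmodule ∧ ∀ v ∈ F, v ∈ U.toSubmodule := by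
  classical
  induction F using Finset.induction_on with
  | empty =>
    refine ⟨⊥, ?_, fun v hv => absurd hv (Finset.notMem_empty v)⟩
    change FiniteDimensional k (⊥ : Submodule k V)
    infer_instance
  | insert a F ha ih =>
    obtain ⟨U, hU, hUF⟩ := ih
    obtain ⟨Ua, haUa, hUa⟩ := hlf a
    haveI := hU
    haveI := hUa
    refine ⟨U ⊔ Ua, ?_, fun v hv => ?_⟩
    · change FiniteDimensional k (U.toSubmodule ⊔ Ua.toSubmodule : Submodule k V)
      infer_instance
    · change v ∈ U.toSubmodule ⊔ Ua.toSubmodule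
      rcases Finset.mem_insert.1 hv with rfl | hv
      · exact Submodule.mem_sup_right haUa
      · exact Submodule.mem_sup_left (hUF v hv)

/-- **Independence of the isotypic components of a LOCALLY FINITE rational representation**
(characteristic `0`): if every vector lies in a finite-dimensional subrepresentation, the
`hwSubrep ρ χ` are independent (reduce a dependency, which involves finitely many highest-weight
vectors, to a finite-dimensional subrepresentation containing them).
[cite: GoodmanWallachGTM255, §4.1.6 (isotypic decomposition)] -/
theorem iSupIndep_hwSubrep_of_locallyFinite [CharZero k] {ρ : Representation k (GL σ k) V}
    (hρ : IsRationalRep ρ)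
    (hlf : ∀ v : V, ∃ U : Subrepresentation ρ, v ∈ U.toSubmodule ∧ FiniteDimensional k U.toSubmodule) :
    iSupIndep fun χ => hwSubrep ρ χ := by
  classical
  intro χ₀
  rw [Submodule.disjoint_def]
  intro x hx hx'
  -- finite data behind the two memberships
  set S : Weight σ → Set V := fun χ =>
    {w | ∃ g : GL σ k, ∃ v ∈ highestWeightSpace ρ χ, w = ρ g v} with hS
  have hx₀ : x ∈ Submodule.span k (S χ₀) := hx
  obtain ⟨T₀, hT₀S, hxT₀⟩ := Submodule.mem_span_finite_of_mem_span hx₀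
  have hle : (⨆ (χ) (_ : χ ≠ χ₀), hwSubrep ρ χ) ≤ Submodule.span k (⋃ (χ) (_ : χ ≠ χ₀), S χ) :=
    iSup₂_le fun χ hχ => Submodule.span_mono (Set.subset_iUnion₂ (s := fun χ (_ : χ ≠ χ₀) => S χ) χ hχ)
  obtain ⟨T₁, hT₁S, hxT₁⟩ := Submodule.mem_span_finite_of_mem_span (hle hx')
  have hgen₀ : ∀ t ∈ T₀, ∃ g : GL σ k, ∃ v ∈ highestWeightSpace ρ χ₀, t = ρ g v :=
    fun t ht => hT₀S ht
  have hgen₁ : ∀ t ∈ T₁, ∃ χ : Weight σ, χ ≠ χ₀ ∧ ∃ g : GL σ k, ∃ v ∈ highestWeightSpace ρ χ,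
      t = ρ g v := by
    intro t ht
    have h := hT₁S ht
    simp only [Set.mem_iUnion, hS, Set.mem_setOf_eq] at h
    obtain ⟨χ, hχ, g, v, hv, htv⟩ := h
    exact ⟨χ, hχ, g, v, hv, htv⟩
  choose! g₀ v₀ hv₀ htv₀ using hgen₀
  choose! wt hwt g₁ v₁ hv₁ htv₁ using hgen₁
  -- a finite-dimensional subrepresentation `U` containing all the highest-weight vectors involved
  obtain ⟨U, hUfd, hU⟩ := exists_subrepresentation_finiteDimensional_forall_mem hlf
    (T₀.image v₀ ∪ T₁.image v₁)
  haveI := hUfd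
  have hU₀ : ∀ t ∈ T₀, v₀ t ∈ U.toSubmodule := fun t ht =>
    hU _ (Finset.mem_union_left _ (Finset.mem_image_of_mem v₀ ht))
  have hU₁ : ∀ t ∈ T₁, v₁ t ∈ U.toSubmodule := fun t ht =>
    hU _ (Finset.mem_union_right _ (Finset.mem_image_of_mem v₁ ht))
  have hρU : IsRationalRep U.toRepresentation := hρ.toRepresentation U
  -- `x` comes from the `χ₀`-component of `U` …
  have hxU₀ : x ∈ (hwSubrep U.toRepresentation χ₀).map U.toSubmodule.subtype := by
    rw [map_subtype_hwSubrep_toRepresentation]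
    refine (Submodule.span_mono fun t ht => ?_) hxT₀
    exact ⟨g₀ t, v₀ t, hv₀ t ht, hU₀ t ht, htv₀ t ht⟩
  -- … and from the other components of `U`
  have hxU₁ : x ∈ (⨆ (χ) (_ : χ ≠ χ₀), hwSubrep U.toRepresentation χ).map U.toSubmodule.subtype := by
    simp only [Submodule.map_iSup, map_subtype_hwSubrep_toRepresentation]
    refine (Submodule.span_le.2 fun t ht => ?_) hxT₁
    refine Submodule.mem_iSup_of_mem (wt t) (Submodule.mem_iSup_of_mem (hwt t ht)
      (Submodule.subset_span ⟨g₁ t, v₁ t, hv₁ t ht, hU₁ t ht, htv₁ t ht⟩))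
  obtain ⟨y₀, hy₀, hy₀x⟩ := Submodule.mem_map.1 hxU₀
  obtain ⟨y₁, hy₁, hy₁x⟩ := Submodule.mem_map.1 hxU₁
  have hyy : y₀ = y₁ := Subtype.ext (hy₀x.trans hy₁x.symm)
  have hd := iSupIndep_hwSubrep hρU χ₀
  rw [Submodule.disjoint_def] at hd
  have hy0 : y₀ = 0 := hd y₀ hy₀ (hyy ▸ hy₁)
  rw [← hy₀x, hy0, map_zero]

/-- From independence: the characterisation "`x' ∈ hwSubrep χ` and `x − x' ∈ ⨆_{χ' ≠ χ} hwSubrep χ'`"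
determines `x'`. [cite: BergEtAl2024, Thm. 1.1 (2), p.4 (PDF p.5)] -/
theorem eq_of_iSupIndep_hwSubrep {ρ : Representation k (GL σ k) V}
    (hind : iSupIndep fun χ => hwSubrep ρ χ) {χ : Weight σ} {x x₁ x₂ : V}
    (h₁ : x₁ ∈ hwSubrep ρ χ) (h₁' : x - x₁ ∈ ⨆ χ' ∈ {χ' : Weight σ | χ' ≠ χ}, hwSubrep ρ χ')
    (h₂ : x₂ ∈ hwSubrep ρ χ) (h₂' : x - x₂ ∈ ⨆ χ' ∈ {χ' : Weight σ | χ' ≠ χ}, hwSubrep ρ χ') :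
    x₁ = x₂ := by
  have hd := hind χ
  rw [Submodule.disjoint_def] at hd
  have hmem : x₁ - x₂ ∈ ⨆ χ' ∈ {χ' : Weight σ | χ' ≠ χ}, hwSubrep ρ χ' := by
    have : x₁ - x₂ = (x - x₂) - (x - x₁) := by abel
    rw [this]
    exact Submodule.sub_mem _ h₂' h₁'
  have hmem' : x₁ - x₂ ∈ ⨆ (χ') (_ : χ' ≠ χ), hwSubrep ρ χ' := by
    simpa only [Set.mem_setOf_eq] using hmem
  exact sub_eq_zero.1 (hd _ (Submodule.sub_mem _ h₁ h₂) hmem')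

/-! ### Highest-weight components: Theorem 1.1 (3) -/

/-- Weight vectors of a subrepresentation are the weight vectors of `V` lying in it.
[cite: GoodmanWallachGTM255, §3.1.3] -/
theorem mem_weightSpace_toRepresentation_iff {ρ : Representation k (GL σ k) V}
    (U : Subrepresentation ρ) (χ : Weight σ) (x : U.toSubmodule) :
    x ∈ weightSpace U.toRepresentation χ ↔ (x : V) ∈ weightSpace ρ χ := by
  simp only [mem_weightSpace_iff]
  refine forall₂_congr fun g _ => ?_
  rw [Subtype.ext_iff, Submodule.coe_smul]
  exact Iff.rfl

/-- `⨆_{χ' ∈ s} hwSubrep ρ χ'` is `GL`-stable. [cite: GoodmanWallachGTM255, §4.1.6] -/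
theorem map_biSup_hwSubrep_le {ρ : Representation k (GL σ k) V} (s : Set (Weight σ)) (g : GL σ k) :
    (⨆ χ' ∈ s, hwSubrep ρ χ').map (ρ g) ≤ ⨆ χ' ∈ s, hwSubrep ρ χ' := by
  simp only [Submodule.map_iSup]
  exact iSup₂_mono fun χ _ => map_hwSubrep_le ρ χ g

/-- **In a locally finite rational representation every vector of a subrepresentation `A` is a
finite sum of weight vectors lying in `A`** (torus weight decomposition of a finite-dimensional
subrepresentation containing it, `exists_weightProj`). [cite: GoodmanWallachGTM255, Thm. 3.1.16] -/
theorem exists_sum_weightVectors_of_mem [CharZero k] {ρ : Representation k (GL σ k) V}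
    (hρ : IsRationalRep ρ)
    (hlf : ∀ v : V, ∃ U : Subrepresentation ρ, v ∈ U.toSubmodule ∧ FiniteDimensional k U.toSubmodule)
    (A : Subrepresentation ρ) {a : V} (ha : a ∈ A.toSubmodule) :
    ∃ (S : Finset (Weight σ)) (c : Weight σ → V),
      (∀ m ∈ S, c m ∈ A.toSubmodule) ∧ (∀ m ∈ S, c m ∈ weightSpace ρ m) ∧ ∑ m ∈ S, c m = a := by
  classical
  haveI : Infinite k := Infinite.of_injective (Nat.cast : ℕ → k) Nat.cast_injective
  obtain ⟨U, haU, hUfd⟩ := hlf a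
  haveI := hUfd
  set W : Subrepresentation ρ := A ⊓ U with hW
  have hWeq : W.toSubmodule = A.toSubmodule ⊓ U.toSubmodule := by
    rw [hW, Subrepresentation.toSubmodule_inf]
  haveI : FiniteDimensional k W.toSubmodule :=
    Submodule.finiteDimensional_of_le (hWeq ▸ inf_le_right)
  have hρW : IsRationalRep W.toRepresentation := hρ.toRepresentation W
  obtain ⟨S, P, hsum, hleft, -⟩ := exists_weightProj hρW
  have haW : a ∈ W.toSubmodule := by
    rw [hWeq]
    exact ⟨ha, haU⟩
  set a' : W.toSubmodule := ⟨a, haW⟩ with ha'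
  refine ⟨S, fun m => ((P m a' : W.toSubmodule) : V), fun m _ => ?_, fun m hm => ?_, ?_⟩
  · have h : ((P m a' : W.toSubmodule) : V) ∈ W.toSubmodule := (P m a').2
    exact (hWeq.le h).1
  · exact (mem_weightSpace_toRepresentation_iff W m _).1
      (weightProj_apply_mem_weightSpace hleft hm a')
  · rw [← Submodule.coe_sum, sum_weightProj_apply hsum a']

/-- **The highest-weight space `V_χ ∩ (χ-isotypic component)` meets
`(⨆_{χ' ≠ χ} hwSubrep χ') + (⨆_{χ' ≠ χ} V_{χ'})` trivially** (locally finite rational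
representation, characteristic `0`): writing `u = a + b`, the weight-`χ` component of `a` lies
again in `⨆_{χ' ≠ χ} hwSubrep χ'` (`exists_sum_weightVectors_of_mem`), `b` has none, so by
independence of the weight spaces `u` equals that component, and then `u = 0` by independence
of the isotypic components. This is what makes "the projection onto the highest weight space
of weight `λ`" of [BDGIL24, Thm. 1.1 (3)] well defined in the tree's rendering (`thm_1_1_hwv`).
[cite: BergEtAl2024, Thm. 1.1 (3), p.4 (PDF p.5)] -/
theorem disjoint_highestWeightSpace_sup_of_locallyFinite [CharZero k]
    {ρ : Representation k (GL σ k) V} (hρ : IsRationalRep ρ)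
    (hlf : ∀ v : V, ∃ U : Subrepresentation ρ, v ∈ U.toSubmodule ∧ FiniteDimensional k U.toSubmodule)
    (χ : Weight σ) :
    Disjoint (highestWeightSpace ρ χ)
      ((⨆ χ' ∈ {χ' : Weight σ | χ' ≠ χ}, hwSubrep ρ χ') ⊔
        (⨆ χ' ∈ {χ' : Weight σ | χ' ≠ χ}, weightSpace ρ χ')) := by
  classical
  haveI : Infinite k := Infinite.of_injective (Nat.cast : ℕ → k) Nat.cast_injective
  rw [Submodule.disjoint_def]
  intro u hu huAB
  obtain ⟨a, ha, b, hb, hab⟩ := Submodule.mem_sup.1 huAB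
  -- the weight components of `a` stay in `A = ⨆_{χ' ≠ χ} hwSubrep χ'`
  let Asub : Subrepresentation ρ :=
    ⟨⨆ χ' ∈ {χ' : Weight σ | χ' ≠ χ}, hwSubrep ρ χ',
      fun g x hx => map_biSup_hwSubrep_le _ g (Submodule.mem_map_of_mem hx)⟩
  obtain ⟨S, c, hcA, hcV, hcsum⟩ := exists_sum_weightVectors_of_mem hρ hlf Asub ha
  -- the weight components of `b`
  have hb' : b ∈ ⨆ (χ') (_ : χ' ≠ χ), weightSpace ρ χ' := by
    simpa only [Set.mem_setOf_eq] using hb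
  obtain ⟨f, hf, hfb⟩ := (Submodule.mem_iSup_iff_exists_finsupp _ b).1 hb'
  have hfχ : f χ = 0 := by
    have h := hf χ
    simp only [ne_eq, not_true_eq_false, iSup_false, Submodule.mem_bot] at h
    exact h
  have hfm : ∀ m, f m ∈ weightSpace ρ m := by
    intro m
    by_cases hm : m = χ
    · rw [hm, hfχ]
      exact Submodule.zero_mem _
    · have h := hf m
      simp only [ne_eq, hm, not_false_eq_true, iSup_pos] at h
      exact h
  -- one dependency among weight vectors
  set T : Finset (Weight σ) := insert χ (S ∪ f.support) with hT
  set y : Weight σ → V := fun m =>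
    (if m ∈ S then c m else 0) + f m - (if m = χ then u else 0) with hy
  have hyV : ∀ m ∈ T, y m ∈ weightSpace ρ m := by
    intro m _
    refine Submodule.sub_mem _ (Submodule.add_mem _ ?_ (hfm m)) ?_
    · split_ifs with h
      · exact hcV m h
      · exact Submodule.zero_mem _
    · split_ifs with h
      · subst h
        exact highestWeightSpace_le_weightSpace _ _ hu
      · exact Submodule.zero_mem _
  have hST : S ⊆ T := fun m hm =>
    Finset.mem_insert_of_mem (Finset.mem_union_left _ hm)
  have hfT : f.support ⊆ T := fun m hm =>
    Finset.mem_insert_of_mem (Finset.mem_union_right _ hm)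
  have hsum : ∑ m ∈ T, y m = 0 := by
    simp only [hy, Finset.sum_sub_distrib, Finset.sum_add_distrib]
    rw [Finset.sum_ite_mem, Finset.inter_eq_right.2 hST, hcsum, Finset.sum_ite_eq' T χ,
      if_pos (Finset.mem_insert_self _ _)]
    have hb2 : ∑ m ∈ T, f m = b := by
      rw [← hfb]
      exact (Finsupp.sum_of_support_subset f hfT (fun _ x => x) fun _ _ => rfl).symm
    rw [hb2, hab, sub_self]
  have hyχ := weightSpace_finset_independent ρ T y hyV hsum χ (Finset.mem_insert_self _ _)
  simp only [hy, hfχ, add_zero, if_true, sub_eq_zero] at hyχ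
  -- so `u ∈ A`, and `u ∈ hwSubrep χ`
  have huA : u ∈ ⨆ χ' ∈ {χ' : Weight σ | χ' ≠ χ}, hwSubrep ρ χ' := by
    rw [← hyχ]
    split_ifs with h
    · exact hcA χ h
    · exact Submodule.zero_mem _
  have huA' : u ∈ ⨆ (χ') (_ : χ' ≠ χ), hwSubrep ρ χ' := by
    simpa only [Set.mem_setOf_eq] using huA
  have hd := iSupIndep_hwSubrep_of_locallyFinite hρ hlf χ
  rw [Submodule.disjoint_def] at hd
  exact hd u (highestWeightSpace_le_hwSubrep ρ χ hu) huA'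

/-! ### The decompositions are exhaustive: direct sums -/

/-- **A locally finite rational representation (characteristic `0`) is the sum of its isotypic
components**: every vector lies in a finite-dimensional subrepresentation, which is spanned by
translates of highest-weight vectors (`le_span_translates_highestWeight`, complete reducibility).
[cite: GoodmanWallachGTM255, §4.1.6 with Thm. 3.3.11] -/
theorem iSup_hwSubrep_eq_top_of_locallyFinite [CharZero k] {ρ : Representation k (GL σ k) V}
    (hρ : IsRationalRep ρ)
    (hlf : ∀ v : V, ∃ U : Subrepresentation ρ, v ∈ U.toSubmodule ∧ FiniteDimensional k U.toSubmodule) :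
    (⨆ χ, hwSubrep ρ χ) = ⊤ := by
  rw [eq_top_iff]
  intro x _
  obtain ⟨U, hxU, hUfd⟩ := hlf x
  haveI := hUfd
  have h := le_span_translates_highestWeight hρ U.toSubmodule
    (fun g y hy => U.apply_mem_toSubmodule g hy) hxU
  refine (Submodule.span_le.2 ?_) h
  rintro _ ⟨g, v, χ, -, hv, rfl⟩
  exact Submodule.mem_iSup_of_mem χ (Submodule.subset_span ⟨g, v, hv, rfl⟩)

/-- **A locally finite rational representation (characteristic `0`) is the sum of its weight
spaces.** [cite: GoodmanWallachGTM255, Thm. 3.1.16] -/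
theorem iSup_weightSpace_eq_top_of_locallyFinite [CharZero k] {ρ : Representation k (GL σ k) V}
    (hρ : IsRationalRep ρ)
    (hlf : ∀ v : V, ∃ U : Subrepresentation ρ, v ∈ U.toSubmodule ∧ FiniteDimensional k U.toSubmodule) :
    (⨆ χ, weightSpace ρ χ) = ⊤ := by
  rw [eq_top_iff]
  intro x _
  obtain ⟨U, hxU, -⟩ := hlf x
  obtain ⟨S, c, -, hcV, hsum⟩ := exists_sum_weightVectors_of_mem hρ hlf U hxU
  rw [← hsum]
  exact Submodule.sum_mem _ fun m hm => Submodule.mem_iSup_of_mem m (hcV m hm)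

end General

/-! ### The metapolynomial representation `coordRep` of [BDGIL24] -/

section CoordRep

open Literature.Computability.AlgebraicComplexity

variable {k d : ℕ}

/-- **Every metapolynomial lies in a finite-dimensional `GL_k`-stable subspace** (the span of its
orbit, finite-dimensional by `exists_finset_forall_coordRep_mem_span`): `coordRep` is locally
finite. [cite: BergEtAl2024, Thm. 1.1 (2) (proof), p.4 (PDF p.5)] -/
theorem exists_subrepresentation_coordRep_mem (Δ : MvPolynomial (DegIdx (Fin k) d) ℂ) :
    ∃ U : Subrepresentation (coordRep (Fin k) ℂ d),
      Δ ∈ U.toSubmodule ∧ FiniteDimensional ℂ U.toSubmodule := by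
  classical
  obtain ⟨T, -, hT⟩ := exists_finset_forall_coordRep_mem_span Δ le_rfl
  have hle : Submodule.span ℂ (Set.range fun g : GL (Fin k) ℂ => coordRep (Fin k) ℂ d g Δ) ≤
      Submodule.span ℂ (T : Set (MvPolynomial (DegIdx (Fin k) d) ℂ)) :=
    Submodule.span_le.2 (by rintro _ ⟨g, rfl⟩; exact hT g)
  haveI := FiniteDimensional.span_of_finite ℂ T.finite_toSet
  exact ⟨⟨Submodule.span ℂ (Set.range fun g : GL (Fin k) ℂ => coordRep (Fin k) ℂ d g Δ),
    fun g x hx => span_orbit_le_comap Δ g hx⟩, self_mem_span_orbit Δ,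
    Submodule.finiteDimensional_of_le hle⟩

/-- **The isotypic components of the space of metapolynomials are independent**: for the
representation `coordRep` of `GL_k(ℂ)` on format-`(*, d, k)` metapolynomials, `⨆_χ hwSubrep χ` is a
direct sum. [cite: BergEtAl2024, §1 ("isotypic component", p.4–5); Thm. 1.1 (2)] -/
theorem iSupIndep_hwSubrep_coordRep (k d : ℕ) :
    iSupIndep fun χ => hwSubrep (coordRep (Fin k) ℂ d) χ :=
  iSupIndep_hwSubrep_of_locallyFinite (isRationalRep_coordRep d) exists_subrepresentation_coordRep_mem

/-- **"The" isotypic projection of [BDGIL24, Thm. 1.1 (2)] is unique**: for a metapolynomial `Δ`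
and a weight `χ`, at most one `Δ'` satisfies `Δ' ∈ hwSubrep χ` and `Δ − Δ' ∈ ⨆_{χ' ≠ χ} hwSubrep χ'`
— the characterisation by which the typed `thm_1_1_isotypic` renders "the projection of `Δ` onto
the `λ`-isotypic component" therefore determines `Δ'`.
[cite: BergEtAl2024, Thm. 1.1 (2), p.4 (PDF p.5)] locator: paper:arxiv-2411.03444 p0005.txt:L77–L79 -/
theorem isotypicComponent_unique {χ : Weight (Fin k)} {Δ Δ₁ Δ₂ : MvPolynomial (DegIdx (Fin k) d) ℂ}
    (h₁ : Δ₁ ∈ hwSubrep (coordRep (Fin k) ℂ d) χ)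
    (h₁' : Δ - Δ₁ ∈ ⨆ χ' ∈ {χ' : Weight (Fin k) | χ' ≠ χ}, hwSubrep (coordRep (Fin k) ℂ d) χ')
    (h₂ : Δ₂ ∈ hwSubrep (coordRep (Fin k) ℂ d) χ)
    (h₂' : Δ - Δ₂ ∈ ⨆ χ' ∈ {χ' : Weight (Fin k) | χ' ≠ χ}, hwSubrep (coordRep (Fin k) ℂ d) χ') :
    Δ₁ = Δ₂ :=
  eq_of_iSupIndep_hwSubrep (iSupIndep_hwSubrep_coordRep k d) h₁ h₁' h₂ h₂'

/-- **The weight spaces of the space of metapolynomials are independent.**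
[cite: BergEtAl2024, §2.3 (weight spaces), p.8; Thm. 1.1 (1)] -/
theorem iSupIndep_weightSpace_coordRep (k d : ℕ) :
    iSupIndep fun χ => weightSpace (coordRep (Fin k) ℂ d) χ :=
  iSupIndep_weightSpace _

/-- **"The" weight projection of [BDGIL24, Thm. 1.1 (1)] is unique**: at most one `Δ'` has
`Δ' ∈ V_χ` and `Δ − Δ' ∈ ⨆_{χ' ≠ χ} V_{χ'}` (the characterisation used by the typed `thm_1_1_weight`).
[cite: BergEtAl2024, Thm. 1.1 (1), p.4 (PDF p.5)] locator: paper:arxiv-2411.03444 p0005.txt:L70–L76 -/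
theorem weightComponent_unique {χ : Weight (Fin k)} {Δ Δ₁ Δ₂ : MvPolynomial (DegIdx (Fin k) d) ℂ}
    (h₁ : Δ₁ ∈ weightSpace (coordRep (Fin k) ℂ d) χ)
    (h₁' : Δ - Δ₁ ∈ ⨆ χ' ∈ {χ' : Weight (Fin k) | χ' ≠ χ}, weightSpace (coordRep (Fin k) ℂ d) χ')
    (h₂ : Δ₂ ∈ weightSpace (coordRep (Fin k) ℂ d) χ)
    (h₂' : Δ - Δ₂ ∈ ⨆ χ' ∈ {χ' : Weight (Fin k) | χ' ≠ χ}, weightSpace (coordRep (Fin k) ℂ d) χ') :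
    Δ₁ = Δ₂ :=
  eq_of_iSupIndep (iSupIndep_weightSpace_coordRep k d) h₁ h₁' h₂ h₂'

/-- **Theorem 1.1 (1) for THE weight projection**: the typed `thm_1_1_weight` (proved in the tree,
`thm_1_1_weight_holds`) bounds `cc` of SOME `Δ'` with the characterising property; by
`weightComponent_unique` that `Δ'` is the only one, so the bound holds for every such `Δ'`.
[cite: BergEtAl2024, Thm. 1.1 (1), p.4 (PDF p.5)] locator: paper:arxiv-2411.03444 p0005.txt:L70–L76 -/
theorem thm_1_1_weight_forall :
    ∃ C : ℕ, ∀ (δ d k s : ℕ) (Δ : MvPolynomial (DegIdx (Fin k) d) ℂ), 1 ≤ d → Δ.IsHomogeneous δ →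
      affComplexity Δ ≤ s → ∀ (χ : Weight (Fin k)) (Δ' : MvPolynomial (DegIdx (Fin k) d) ℂ),
        Δ' ∈ weightSpace (coordRep (Fin k) ℂ d) χ →
        Δ - Δ' ∈ ⨆ χ' ∈ {χ' : Weight (Fin k) | χ' ≠ χ}, weightSpace (coordRep (Fin k) ℂ d) χ' →
        affComplexity Δ' ≤ C * s * (δ * d) ^ (2 * k ^ 3) := by
  obtain ⟨C, hC⟩ := thm_1_1_weight_holds
  refine ⟨C, fun δ d k s Δ hd hΔ hs χ Δ' h₁ h₁' => ?_⟩
  obtain ⟨Δ₀, h₀, h₀', hcc⟩ := hC δ d k s Δ hd hΔ hs χ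
  rw [weightComponent_unique h₁ h₁' h₀ h₀']
  exact hcc

/-- **Theorem 1.1 (2) for THE isotypic projection**: the typed `thm_1_1_isotypic` (proved in the
tree, `thm_1_1_isotypic_holds`) bounds `cc` of SOME `Δ'` with `Δ' ∈ hwSubrep χ`,
`Δ − Δ' ∈ ⨆_{χ' ≠ χ} hwSubrep χ'`; by `isotypicComponent_unique` the bound holds for every such
`Δ'` — i.e. for the projection of `Δ` onto the `λ`-isotypic component.
[cite: BergEtAl2024, Thm. 1.1 (2), p.4 (PDF p.5)] locator: paper:arxiv-2411.03444 p0005.txt:L77–L79 -/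
theorem thm_1_1_isotypic_forall :
    ∃ C : ℕ, ∀ (δ d k s : ℕ) (Δ : MvPolynomial (DegIdx (Fin k) d) ℂ), 1 ≤ d → Δ.IsHomogeneous δ →
      affComplexity Δ ≤ s → ∀ (χ : Weight (Fin k)) (Δ' : MvPolynomial (DegIdx (Fin k) d) ℂ),
        Δ' ∈ hwSubrep (coordRep (Fin k) ℂ d) χ →
        Δ - Δ' ∈ ⨆ χ' ∈ {χ' : Weight (Fin k) | χ' ≠ χ}, hwSubrep (coordRep (Fin k) ℂ d) χ' →
        affComplexity Δ' ≤ C * s * k ^ (2 * k ^ 2) * (δ * d) ^ (2 * k ^ 3) := by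
  obtain ⟨C, hC⟩ := thm_1_1_isotypic_holds
  refine ⟨C, fun δ d k s Δ hd hΔ hs χ Δ' h₁ h₁' => ?_⟩
  obtain ⟨Δ₀, h₀, h₀', hcc⟩ := hC δ d k s Δ hd hΔ hs χ
  rw [isotypicComponent_unique h₁ h₁' h₀ h₀']
  exact hcc

/-- **"The" highest-weight projection of [BDGIL24, Thm. 1.1 (3)] is unique**: at most one `Δ'` has
`Δ' ∈ highestWeightSpace χ` and `Δ − Δ' ∈ (⨆_{χ' ≠ χ} hwSubrep χ') + (⨆_{χ' ≠ χ} V_{χ'})` (the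
characterisation used by the typed `thm_1_1_hwv`).
[cite: BergEtAl2024, Thm. 1.1 (3), p.4 (PDF p.5)] locator: paper:arxiv-2411.03444 p0005.txt:L80–L81 -/
theorem hwvComponent_unique {χ : Weight (Fin k)} {Δ Δ₁ Δ₂ : MvPolynomial (DegIdx (Fin k) d) ℂ}
    (h₁ : Δ₁ ∈ highestWeightSpace (coordRep (Fin k) ℂ d) χ)
    (h₁' : Δ - Δ₁ ∈ (⨆ χ' ∈ {χ' : Weight (Fin k) | χ' ≠ χ}, hwSubrep (coordRep (Fin k) ℂ d) χ') ⊔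
      (⨆ χ' ∈ {χ' : Weight (Fin k) | χ' ≠ χ}, weightSpace (coordRep (Fin k) ℂ d) χ'))
    (h₂ : Δ₂ ∈ highestWeightSpace (coordRep (Fin k) ℂ d) χ)
    (h₂' : Δ - Δ₂ ∈ (⨆ χ' ∈ {χ' : Weight (Fin k) | χ' ≠ χ}, hwSubrep (coordRep (Fin k) ℂ d) χ') ⊔
      (⨆ χ' ∈ {χ' : Weight (Fin k) | χ' ≠ χ}, weightSpace (coordRep (Fin k) ℂ d) χ')) :
    Δ₁ = Δ₂ := by
  have hd := disjoint_highestWeightSpace_sup_of_locallyFinite (isRationalRep_coordRep d)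
    (exists_subrepresentation_coordRep_mem (k := k) (d := d)) χ
  rw [Submodule.disjoint_def] at hd
  have hmem : Δ₁ - Δ₂ ∈ (⨆ χ' ∈ {χ' : Weight (Fin k) | χ' ≠ χ}, hwSubrep (coordRep (Fin k) ℂ d) χ') ⊔
      (⨆ χ' ∈ {χ' : Weight (Fin k) | χ' ≠ χ}, weightSpace (coordRep (Fin k) ℂ d) χ') := by
    have : Δ₁ - Δ₂ = (Δ - Δ₂) - (Δ - Δ₁) := by abel
    rw [this]
    exact Submodule.sub_mem _ h₂' h₁'
  exact sub_eq_zero.1 (hd _ (Submodule.sub_mem _ h₁ h₂) hmem)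

/-- **Theorem 1.1 (3) for THE highest-weight projection**: the tree's `thm_1_1_hwv_holds` bounds
`cc` of SOME `Δ'` with the characterising property; by `hwvComponent_unique` the bound holds for
every such `Δ'`. [cite: BergEtAl2024, Thm. 1.1 (3), p.4 (PDF p.5)] locator: paper:arxiv-2411.03444 p0005.txt:L80–L81 -/
theorem thm_1_1_hwv_forall :
    ∃ C : ℕ, ∀ (δ d k s : ℕ) (Δ : MvPolynomial (DegIdx (Fin k) d) ℂ), 1 ≤ d → Δ.IsHomogeneous δ →
      affComplexity Δ ≤ s → ∀ (χ : Weight (Fin k)) (Δ' : MvPolynomial (DegIdx (Fin k) d) ℂ),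
        Δ' ∈ highestWeightSpace (coordRep (Fin k) ℂ d) χ →
        Δ - Δ' ∈ (⨆ χ' ∈ {χ' : Weight (Fin k) | χ' ≠ χ}, hwSubrep (coordRep (Fin k) ℂ d) χ') ⊔
          (⨆ χ' ∈ {χ' : Weight (Fin k) | χ' ≠ χ}, weightSpace (coordRep (Fin k) ℂ d) χ') →
        affComplexity Δ' ≤ C * s * (k + 1) ^ (2 * k ^ 2) * (δ * d) ^ (2 * k ^ 3) := by
  obtain ⟨C, hC⟩ := thm_1_1_hwv_holds
  refine ⟨C, fun δ d k s Δ hd hΔ hs χ Δ' h₁ h₁' => ?_⟩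
  obtain ⟨Δ₀, h₀, h₀', hcc⟩ := hC δ d k s Δ hd hΔ hs χ
  rw [hwvComponent_unique h₁ h₁' h₀ h₀']
  exact hcc

/-- **The space of format-`(*, d, k)` metapolynomials is the DIRECT SUM of its isotypic
components** `hwSubrep (coordRep (Fin k) ℂ d) χ` (independent and exhaustive).
[cite: BergEtAl2024, §1 ("isotypic component", p.4–5); §2.5] -/
theorem isInternal_hwSubrep_coordRep (k d : ℕ) :
    DirectSum.IsInternal fun χ => hwSubrep (coordRep (Fin k) ℂ d) χ :=
  DirectSum.isInternal_submodule_of_iSupIndep_of_iSup_eq_top (iSupIndep_hwSubrep_coordRep k d)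
    (iSup_hwSubrep_eq_top_of_locallyFinite (isRationalRep_coordRep d)
      exists_subrepresentation_coordRep_mem)

/-- **The space of format-`(*, d, k)` metapolynomials is the DIRECT SUM of its weight spaces.**
[cite: BergEtAl2024, §2.3 (weight spaces), p.8] -/
theorem isInternal_weightSpace_coordRep (k d : ℕ) :
    DirectSum.IsInternal fun χ => weightSpace (coordRep (Fin k) ℂ d) χ :=
  DirectSum.isInternal_submodule_of_iSupIndep_of_iSup_eq_top (iSupIndep_weightSpace_coordRep k d)
    (iSup_weightSpace_eq_top_of_locallyFinite (isRationalRep_coordRep d)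
      exists_subrepresentation_coordRep_mem)

end CoordRep


end BergEtAl2024

end Literature.Barriers.ValiantsHypothesis
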